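import Mathlib
import Summits.NavierStokesRegularity.NavierStokesRegularity.Theorems.EulerZoomLiouvillePowerGaugeEulerLiouvilleGalileanFrameSteadyEuler
import Summits.NavierStokesRegularity.NavierStokesRegularity.Theorems.EulerZoomLiouvillePowerGaugeEulerLiouvillePastFrameSteadyConfined
import Summits.NavierStokesRegularity.NavierStokesRegularity.Theorems.EulerZoomLiouvillePowerGaugeEulerLiouvillePastFrameSteadyTools
import Summits.NavierStokesRegularity.NavierStokesRegularity.Theorems.EulerZoomLiouvillePowerGaugeEulerLiouvilleBackwardTools
import Summits.NavierStokesRegularity.NavierStokesRegularity.Theorems.EulerZoomLiouvillePowerGaugeEulerLiouvilleSelfSimilarTransfer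
import Summits.NavierStokesRegularity.NavierStokesRegularity.Theorems.EulerZoomLiouvillePowerGaugeEulerLiouvilleSelfSimilarPastSubExtremal
import Summits.NavierStokesRegularity.NavierStokesRegularity.Theorems.EulerZoomLiouvillePowerGaugeEulerLiouvilleEnergySaturationShellLoc
import Literature.Analysis.FluidPDE.SuitableWeakCongr
import HarnessLib

/-!
# Crux E `PowerGaugeEulerLiouville` (stmt-NavierStokesRegularity-19832), line `galilean-frames` (ns-idea-11 g6): STUB F1e
# `stub_frameSteadyEscaping` AND F1 `stub_frameSteady` — FRAME-STEADY PAST MEMBERS OF SEREGIN'S CLASS ARE TRIVIAL (width seat ns-ezl-w3 g5)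

Route №10 `EulerZoomLiouville` (NavierStokesRegularity), crux E.  The line `galilean-frames`
(`Cruxes/PowerGaugeEulerLiouville/Lines/galilean_frames.lean`, rev5) files the relative equilibria of the similarity dynamics modulo the
extended Galilei group; its stub F1 says that a FRAME-STEADY past member `u(τ, y) = U(y − ξ(τ)) + η(τ)` (`τ < T₁ ≤ 0`; ONE profile `U`
carried along an arbitrary `C¹` frame path `ξ` with an arbitrary uniform background `η`) of Seregin's power-gauged ancient Euler class is
trivial.  F1 = F1c (sub-critically confined frames; ns-ezl-w6 g2, `FrameSteady.ae_eq_zero_of_gauge_of_pastFrameSteady_confined`, p648182) +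
F1e (escaping frames, OPEN until now).  This file closes F1e — in fact F1 outright, the escaping hypothesis is not used:

* `ae_eq_comp_add_of_mem_span` — a.e. translation invariance of a field along a set of directions propagates to their linear span;
* `sub_affine_mem_of_deriv_sub_mem` — a `C¹` path whose velocity increments `ξ'(τ) − ξ'(τ₀)` lie in a subspace `D` is affine modulo `D`;
* **`frameSteady_ae_eq_zero`** — THE STRATUM: crux hypotheses verbatim (`0 < ρ ≤ 1/2`) + `u τ = fun y => U (y − ξ τ) + η τ` for `τ < T₁`
  (`T₁ ≤ 0`, `ξ ∈ C¹`) ⇒ `u = 0` a.e. on the slab;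
* **`frameSteadyEscaping`** = `Sig.stub_frameSteadyEscaping` (body verbatim; the line's reducible `InClass` / `VanishesAE` and its
  `IsSubcriticalFrame` unfolded) and **`frameSteady_stratum`** = `Sig.stub_frameSteady` (body verbatim, `IsPastFrameSteady` unfolded):
  wiring `theorem stub_frameSteadyEscaping : Sig.stub_frameSteadyEscaping := …GalileanFrames.frameSteadyEscaping`.

PROOF (levers (L1) + (L2) of the line, all kernel-checked in this lineage): (0) the background is constant and is absorbed into the profile
(`FrameSteady.exists_profile_noBackground`, ns-ezl-w6 g2); (1) a good slice gives `U ∈ L¹_loc` and the A-gauge growth `∫_{B_R}|U|² ≤ C R^{1−2ρ}`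
(`Backward.lintegral_ball_le_of_gaugeA`), hence `|U|² ∈ L¹_loc`; (2) the tensor-tested weak Euler equation in the moving frame
(`…GalileanFrameSteadyEuler`: `∫⟪U, DΦ·ξ'(τ)⟫ = ∫⟪U, DΦ·U⟫` at every `τ < T₁`) makes `∂_e U` WEAKLY A GRADIENT for every increment
`e = ξ'(τ₁) − ξ'(τ₂)`, and the profile weakly divergence free; (3) the first lemma `GalileanFrames.harmonicShearVanishes` (ns-ezl-w3 g4, p657454) gives
`U(· + s e) = U` a.e., hence invariance along the span `D` of the increments; (4) `ξ − ξ_aff` takes values in `D` for the AFFINE path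
`ξ_aff(τ) = ξ(τ₀) + (τ − τ₀)ξ'(τ₀)`, so the slice-wise a.e.-modified member `u'(τ) = U(· − ξ_aff(τ))` is still in the class with the same gauges
(`IsSuitableWeakSolutionOn.congr_ae`, `HasWeakSpatialGradientOn.congr_ae`, `cknA_congr_of_slice_ae`) and is frame-steady with a sub-critically
confined path (`β = 1`, `1·(1−ρ) < 1`); (5) F1c kills it.

WHAT THIS IS NOT: not NS regularity, not the crux E (stmt-19832 stays OPEN: the three open stubs of the skeleton of record are untouched) —
one symmetry stratum of the crux CLASS 19832 (MODEL lattice; E/NS strata): the Galilean-twisted slice of the symmetry classification is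
EMPTY beyond the anchored one.  `--supports` stmt-19832. [folklore; MajdaBertozzi2002 Prop. 1.1 p. 12 (extended Galilean invariance)]
-/

noncomputable section

-- flat `Theorems/<Route><Decl>…` files of one crux share the namespace of the crux (tree convention: `Summit.<S>.<S>.…`)
set_option linter.dupNamespace false

open MeasureTheory Set Filter Topology Metric Function TopologicalSpace InnerProductSpace
open scoped ENNReal NNReal RealInnerProductSpace ContDiff

namespace Summit.NavierStokesRegularity.NavierStokesRegularity.Theorems.PowerGaugeEulerLiouville

namespace GalileanFrames

open Literature.Analysis Literature.Analysis.FunctionSpaces Literature.Analysis.FluidPDE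
open Summit.NavierStokesRegularity.NavierStokesRegularity.Theorems.PowerGaugeEulerLiouville

variable {U : EuclideanSpace ℝ (Fin 3) → EuclideanSpace ℝ (Fin 3)} {ξ : ℝ → EuclideanSpace ℝ (Fin 3)}

/-! ## F1e: FRAME-STEADY MEMBERS ARE TRIVIAL (steps (iii)–(iv) and the kill) -/

section Stratum

variable {u : ℝ → EuclideanSpace ℝ (Fin 3) → EuclideanSpace ℝ (Fin 3)} {p : ℝ → EuclideanSpace ℝ (Fin 3) → ℝ}
  {H : ℝ → EuclideanSpace ℝ (Fin 3) → EuclideanSpace ℝ (Fin 3) →L[ℝ] EuclideanSpace ℝ (Fin 3)} {c : ℝ≥0} {T₁ : ℝ}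

/-- `cknA` only sees the slices of the field on the time interval of the cylinder: slice-wise a.e. equality there gives equal `cknA`.
[folklore] -/
theorem cknA_congr_of_slice_ae {v w : ℝ → EuclideanSpace ℝ (Fin 3) → EuclideanSpace ℝ (Fin 3)} {r : ℝ}
    {z : ℝ × EuclideanSpace ℝ (Fin 3)} (h : ∀ t ∈ Ioo (z.1 - r ^ 2) z.1, v t =ᵐ[volume] w t) :
    cknA r z v = cknA r z w := by
  -- adapted from Theorems/SelfMixingDichotomyCoherentScaleExclusionTypeIRegime.lean (`cknA_congr_slice_ae`)
  unfold cknA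
  refine iSup_congr fun t => iSup_congr fun ht => ?_
  congr 1
  refine lintegral_congr_ae (ae_restrict_of_ae ((h t ht).mono fun x hx => ?_))
  show ‖v t x‖ₑ ^ 2 = ‖w t x‖ₑ ^ 2
  rw [hx]

/-- **Translation invariance propagates along the span.**  If `U(· + s e) = U` a.e. for every `s` and every `e` in a set `S`, then
`U(· + d) = U` a.e. for every `d` in the linear span of `S`. [folklore] -/
theorem ae_eq_comp_add_of_mem_span {S : Set (EuclideanSpace ℝ (Fin 3))}
    (h : ∀ e ∈ S, ∀ s : ℝ, (fun z => U (z + s • e)) =ᵐ[volume] U) {d : EuclideanSpace ℝ (Fin 3)}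
    (hd : d ∈ Submodule.span ℝ S) : (fun z => U (z + d)) =ᵐ[volume] U := by
  suffices hP : ∀ s : ℝ, (fun z => U (z + s • d)) =ᵐ[volume] U by simpa using hP 1
  induction hd using Submodule.span_induction with
  | mem x hx => exact h x hx
  | zero => intro s; simp
  | add x y _ _ hx hy =>
      intro s
      have h1 : (fun z => U (z + s • y + s • x)) =ᵐ[volume] fun z => U (z + s • y) :=
        (measurePreserving_add_right volume (s • y)).quasiMeasurePreserving.ae_eq_comp (hx s)
      have e : (fun z => U (z + s • (x + y))) = fun z => U (z + s • y + s • x) := by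
        funext z; rw [smul_add, add_assoc, add_comm (s • x)]
      rw [e]
      exact h1.trans (hy s)
  | smul a x _ hx =>
      intro s
      have e : (fun z => U (z + s • a • x)) = fun z => U (z + (s * a) • x) := by
        funext z; rw [smul_smul]
      rw [e]
      exact hx (s * a)

/-- **A `C¹` path whose velocity increments lie in a subspace is affine modulo that subspace**: if `ξ'(τ) − ξ'(τ₀) ∈ D` for all `τ < T₁`
(`τ₀ < T₁`), then `ξ(τ) − ξ(τ₀) − (τ − τ₀)ξ'(τ₀) ∈ D` for all `τ < T₁`. [folklore] -/
theorem sub_affine_mem_of_deriv_sub_mem (hξ : ContDiff ℝ 1 ξ) {D : Submodule ℝ (EuclideanSpace ℝ (Fin 3))} {τ₀ : ℝ}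
    (hτ₀ : τ₀ < T₁) (hD : ∀ τ : ℝ, τ < T₁ → deriv ξ τ - deriv ξ τ₀ ∈ D) {τ : ℝ} (hτ : τ < T₁) :
    ξ τ - ξ τ₀ - (τ - τ₀) • deriv ξ τ₀ ∈ D := by
  have hξd : Differentiable ℝ ξ := hξ.differentiable (by simp)
  -- test against the orthogonal complement
  rw [← Submodule.orthogonal_orthogonal D, Submodule.mem_orthogonal]
  intro w hw
  set φ : ℝ → ℝ := fun t => ⟪w, ξ t - ξ τ₀ - (t - τ₀) • deriv ξ τ₀⟫ with hφ
  have hφd : ∀ t, HasDerivAt φ ⟪w, deriv ξ t - deriv ξ τ₀⟫ t := by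
    intro t
    have h1 : HasDerivAt (fun t : ℝ => ξ t - ξ τ₀ - (t - τ₀) • deriv ξ τ₀) (deriv ξ t - (1 : ℝ) • deriv ξ τ₀) t :=
      ((hξd t).hasDerivAt.sub_const (ξ τ₀)).sub (((hasDerivAt_id t).sub_const τ₀).smul_const (deriv ξ τ₀))
    rw [one_smul] at h1
    exact (hasDerivAt_const t w).inner ℝ h1 |>.congr_deriv (by simp)
  have hconst : φ τ = φ τ₀ := by
    refine IsOpen.is_const_of_deriv_eq_zero isOpen_Iio isPreconnected_Iio (fun t _ => (hφd t).differentiableAt.differentiableWithinAt)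
      (fun t ht => ?_) hτ hτ₀
    rw [(hφd t).deriv]
    exact (Submodule.inner_left_of_mem_orthogonal (hD t ht) hw)
  have h0 : φ τ₀ = 0 := by simp [hφ]
  show φ τ = 0
  rw [hconst, h0]

/-- **FRAME-STEADY PAST MEMBERS OF SEREGIN'S CLASS ARE TRIVIAL** (line `galilean-frames`, stub F1 = F1c + F1e; `0 < ρ ≤ 1/2`).
Let `(u, p)` be a suitable weak Euler pair on `(−∞,0) × ℝ³` with weak spatial gradient `H` in Seregin's power-gauged class
`a^{2ρ}A(a) + a^{ρ}E(a) + a^{2ρ}D(a) ≤ c` (all `a > 0`), and suppose `u(τ, ·) = U(· − ξ(τ)) + η(τ)` for all `τ < T₁ ≤ 0` with an arbitrary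
profile `U`, background `η` and a `C¹` frame path `ξ`.  Then `u = 0` a.e. on the slab.
PROOF (levers (L1) + (L2) of the line): the background is constant and can be absorbed (`FrameSteady.exists_profile_noBackground`); the
weak Euler equation in the moving frame makes `∂_e U` weakly a gradient for every increment `e = ξ'(τ₁) − ξ'(τ₂)` of the frame velocity
(`integral_inner_fderiv_frameAcceleration_eq_zero`), so `U` is invariant along `e` (`harmonicShearVanishes`, ns-ezl-w3 g4) and along the span
`D` of these increments; `ξ` is affine modulo `D`, so after a slice-wise a.e. modification the member is frame-steady with the AFFINE path
`ξ(τ₀) + (τ − τ₀)ξ'(τ₀)` — sub-critically confined (`β = 1 < 1/(1−ρ)`) — and the confined theorem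
`FrameSteady.ae_eq_zero_of_gauge_of_pastFrameSteady_confined` (ns-ezl-w6 g2) kills it. [folklore; MajdaBertozzi2002 Prop. 1.1 p. 12] -/
theorem frameSteady_ae_eq_zero {ρ : ℝ} (hρ : 0 < ρ) (hρ2 : ρ ≤ 1 / 2)
    (hsw : IsSuitableWeakSolutionOn (slab (EuclideanSpace ℝ (Fin 3)) (Iio 0) isOpen_Iio) 0 0 u p)
    (hH : HasWeakSpatialGradientOn (slab (EuclideanSpace ℝ (Fin 3)) (Iio 0) isOpen_Iio) u H)
    (hc : ∀ a : ℝ, 0 < a → ENNReal.ofReal (a ^ (2 * ρ)) * cknA a (0 : ℝ × EuclideanSpace ℝ (Fin 3)) u +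
        ENNReal.ofReal (a ^ ρ) * cknE a (0 : ℝ × EuclideanSpace ℝ (Fin 3)) H +
        ENNReal.ofReal (a ^ (2 * ρ)) * cknD a (0 : ℝ × EuclideanSpace ℝ (Fin 3)) p ≤ (c : ℝ≥0∞))
    (hT₁ : T₁ ≤ 0) (hξ : ContDiff ℝ 1 ξ) {η : ℝ → EuclideanSpace ℝ (Fin 3)}
    (hu : ∀ τ : ℝ, τ < T₁ → u τ = fun y => U (y - ξ τ) + η τ) :
    uncurry u =ᵐ[volume.restrict (Iio (0 : ℝ) ×ˢ (univ : Set (EuclideanSpace ℝ (Fin 3))))] 0 := by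
  have hρ1 : ρ < 1 := by linarith
  have hA : ∀ a : ℝ, 0 < a → ENNReal.ofReal (a ^ (2 * ρ)) * cknA a (0 : ℝ × EuclideanSpace ℝ (Fin 3)) u ≤ (c : ℝ≥0∞) :=
    fun a ha => le_trans (le_trans le_self_add le_self_add) (hc a ha)
  have hsol : IsDistributionalNSSolutionOn (slab (EuclideanSpace ℝ (Fin 3)) (Iio 0) isOpen_Iio) 0 0 u p := hsw.distributional
  have hξc : Continuous ξ := hξ.continuous
  -- ### (0) no background
  obtain ⟨U₀, hU₀m, hu₀⟩ := FrameSteady.exists_profile_noBackground hH hT₁ hu (by linarith : (-1 : ℝ) < ρ) hA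
  -- ### (1) a good slice: `U₀ ∈ L¹_loc`, and the A-gauge growth `∫_{B_R} |U₀|² ≤ C R^{1−2ρ}` (`R ≥ 1`)
  have hne : (ae (volume.restrict (Iio T₁))).NeBot := by
    rw [ae_neBot, Ne, Measure.restrict_eq_zero, Real.volume_Iio]; exact ENNReal.top_ne_zero
  obtain ⟨τ₀, hτ₀W, hτ₀T⟩ := ((FrameSteady.ae_hasWeakFDerivOn_slice_past hH hT₁).and (ae_restrict_mem measurableSet_Iio)).exists
  have hτ₀T : τ₀ < T₁ := hτ₀T
  have hU₀eq : U₀ = fun z => u τ₀ (z + ξ τ₀) := by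
    funext z; rw [hu₀ τ₀ hτ₀T]; simp
  have hUl : LocallyIntegrable U₀ volume := by
    have h1 : LocallyIntegrable (u τ₀) volume :=
      locallyIntegrableOn_univ.1 (by simpa only [Opens.coe_top] using hτ₀W.locallyIntegrableOn)
    rw [hU₀eq]; exact locallyIntegrable_comp_add_right h1 (ξ τ₀)
  -- the growth at large radii
  set R₀ : ℝ := 2 - T₁ + |τ₀| + ‖ξ τ₀‖ with hR₀
  have hR₀1 : 1 ≤ R₀ := by rw [hR₀]; linarith [abs_nonneg τ₀, norm_nonneg (ξ τ₀)]
  have hgrowR₀ : ∀ R : ℝ, R₀ ≤ R → ∫⁻ z in ball (0 : EuclideanSpace ℝ (Fin 3)) R, ‖U₀ z‖ₑ ^ 2 ≤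
      (2 * (c : ℝ≥0∞)) * ENNReal.ofReal (R ^ (1 - 2 * ρ)) := by
    intro R hR
    have hR1 : 1 ≤ R := hR₀1.trans hR
    have hR0 : 0 < R := by linarith
    have h2R : 0 < 2 * R := by linarith
    have hτ₀I : τ₀ ∈ Ioo (-((2 * R) ^ 2)) 0 := by
      refine ⟨?_, lt_of_lt_of_le hτ₀T hT₁⟩
      have : |τ₀| ≤ R := by rw [hR₀] at hR; linarith [norm_nonneg (ξ τ₀)]
      nlinarith [neg_abs_le τ₀, abs_nonneg τ₀]
    have hAs := Backward.lintegral_ball_le_of_gaugeA h2R (hA (2 * R) h2R) hτ₀I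
    have hξR : ‖ξ τ₀‖ ≤ R := by rw [hR₀] at hR; linarith [abs_nonneg τ₀]
    calc ∫⁻ z in ball (0 : EuclideanSpace ℝ (Fin 3)) R, ‖U₀ z‖ₑ ^ 2
        = ∫⁻ z in ball (0 : EuclideanSpace ℝ (Fin 3)) R, ‖u τ₀ (z + ξ τ₀)‖ₑ ^ 2 := by rw [hU₀eq]
      _ ≤ ∫⁻ z in ball (0 : EuclideanSpace ℝ (Fin 3)) (2 * R), ‖u τ₀ z‖ₑ ^ 2 :=
          FrameSteady.setLIntegral_ball_translate_le (fun z => ‖u τ₀ z‖ₑ ^ 2) hξR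
      _ ≤ ENNReal.ofReal ((c : ℝ) * (2 * R) ^ (1 - 2 * ρ)) := hAs
      _ ≤ (2 * (c : ℝ≥0∞)) * ENNReal.ofReal (R ^ (1 - 2 * ρ)) := by
          have h2 : (2 : ℝ) ^ (1 - 2 * ρ) ≤ 2 ^ (1 : ℝ) := Real.rpow_le_rpow_of_exponent_le one_le_two (by linarith)
          rw [Real.rpow_one] at h2
          have h3 : (c : ℝ) * (2 * R) ^ (1 - 2 * ρ) ≤ 2 * (c : ℝ) * R ^ (1 - 2 * ρ) := by
            rw [Real.mul_rpow zero_le_two hR0.le]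
            have hRe := Real.rpow_nonneg hR0.le (1 - 2 * ρ)
            calc (c : ℝ) * ((2 : ℝ) ^ (1 - 2 * ρ) * R ^ (1 - 2 * ρ)) = (2 : ℝ) ^ (1 - 2 * ρ) * ((c : ℝ) * R ^ (1 - 2 * ρ)) := by ring
              _ ≤ 2 * ((c : ℝ) * R ^ (1 - 2 * ρ)) := mul_le_mul_of_nonneg_right h2 (mul_nonneg c.coe_nonneg hRe)
              _ = 2 * (c : ℝ) * R ^ (1 - 2 * ρ) := by ring
          calc ENNReal.ofReal ((c : ℝ) * (2 * R) ^ (1 - 2 * ρ)) ≤ ENNReal.ofReal (2 * (c : ℝ) * R ^ (1 - 2 * ρ)) :=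
                ENNReal.ofReal_le_ofReal h3
            _ = (2 * (c : ℝ≥0∞)) * ENNReal.ofReal (R ^ (1 - 2 * ρ)) := by
                rw [ENNReal.ofReal_mul (by positivity), ENNReal.ofReal_mul zero_le_two, ENNReal.ofReal_ofNat,
                  ENNReal.ofReal_coe_nnreal]
  -- down to `R ≥ 1`
  have hgrow1 := Past.growth_ge_one_of_growth_ge (f := fun z => ‖U₀ z‖ₑ ^ 2) hR₀1 (by linarith : (0 : ℝ) ≤ 1 - 2 * ρ) hgrowR₀
  set Cg : ℝ≥0∞ := 2 * (c : ℝ≥0∞) * ENNReal.ofReal (R₀ ^ (1 - 2 * ρ)) with hCg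
  have hCgtop : Cg ≠ ⊤ := ENNReal.mul_ne_top (ENNReal.mul_ne_top ENNReal.ofNat_ne_top ENNReal.coe_ne_top) ENNReal.ofReal_ne_top
  have hgrowC : ∀ R : ℝ, 1 ≤ R → ∫⁻ z in ball (0 : EuclideanSpace ℝ (Fin 3)) R, ‖U₀ z + 0‖ₑ ^ 2 ≤
      ENNReal.ofReal (Cg.toReal * R ^ (1 - 2 * ρ)) := by
    intro R hR
    have h := hgrow1 R hR
    simp only [add_zero]
    rw [ENNReal.ofReal_mul ENNReal.toReal_nonneg, ENNReal.ofReal_toReal hCgtop]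
    exact h
  -- `|U₀|² ∈ L¹_loc`
  have hU2 : LocallyIntegrable (fun z => ‖U₀ z‖ ^ 2) volume := by
    refine EnergySaturation.locallyIntegrable_norm_sq_of_growth_loc (ρ := ρ) hU₀m (c := Cg.toNNReal) fun L hL => ?_
    rw [ENNReal.coe_toNNReal hCgtop]
    exact hgrow1 L hL
  -- ### (2) the profile is weakly divergence free; (3) the frame acceleration is weakly a gradient; (4) invariance along the span
  have hdivU : ∀ φ : EuclideanSpace ℝ (Fin 3) → ℝ, ContDiff ℝ (⊤ : ℕ∞) φ → HasCompactSupport φ → ∫ z, ⟪U₀ z, gradient φ z⟫ = 0 :=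
    fun φ hφ hφc => frameProfile_integral_inner_gradient_eq_zero hsol hT₁ hu₀ hUl hξ hφ hφc
  set S : Set (EuclideanSpace ℝ (Fin 3)) := {e | ∃ τ₁ τ₂ : ℝ, τ₁ < T₁ ∧ τ₂ < T₁ ∧ e = deriv ξ τ₁ - deriv ξ τ₂} with hS
  set D : Submodule ℝ (EuclideanSpace ℝ (Fin 3)) := Submodule.span ℝ S with hDdef
  have hinvS : ∀ e ∈ S, ∀ s : ℝ, (fun z => U₀ (z + s • e)) =ᵐ[volume] U₀ := by
    rintro e ⟨τ₁, τ₂, hτ₁, hτ₂, rfl⟩ s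
    refine harmonicShearVanishes ρ hρ U₀ 0 (deriv ξ τ₁ - deriv ξ τ₂) Cg.toReal hUl hgrowC hdivU ?_ s
    intro Φ hΦ hΦc htr
    exact integral_inner_fderiv_frameAcceleration_eq_zero hsol hT₁ hu₀ hU₀m hUl hU2 hξ ⟨hΦ, hΦc, by simp⟩ htr hτ₁ hτ₂
  have hinvD : ∀ d ∈ D, (fun z => U₀ (z + d)) =ᵐ[volume] U₀ := fun d hd => ae_eq_comp_add_of_mem_span hinvS hd
  -- ### (5) the affine representative of the frame path
  set ξa : ℝ → EuclideanSpace ℝ (Fin 3) := fun τ => ξ τ₀ + (τ - τ₀) • deriv ξ τ₀ with hξa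
  have hmemD : ∀ τ : ℝ, τ < T₁ → ξ τ - ξa τ ∈ D := by
    intro τ hτ
    have h := sub_affine_mem_of_deriv_sub_mem hξ (D := D) hτ₀T
      (fun t ht => Submodule.subset_span ⟨t, τ₀, ht, hτ₀T, rfl⟩) hτ
    have e : ξ τ - ξa τ = ξ τ - ξ τ₀ - (τ - τ₀) • deriv ξ τ₀ := by
      show ξ τ - (ξ τ₀ + (τ - τ₀) • deriv ξ τ₀) = _
      rw [sub_add_eq_sub_sub]
    rw [e]; exact h
  have hslice : ∀ τ : ℝ, τ < T₁ → (fun y => U₀ (y - ξa τ)) =ᵐ[volume] u τ := by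
    intro τ hτ
    have h1 : (fun z => U₀ (z + -(ξ τ - ξa τ))) =ᵐ[volume] U₀ := hinvD _ (D.neg_mem (hmemD τ hτ))
    have h2 : (fun y => U₀ (y - ξa τ + -(ξ τ - ξa τ))) =ᵐ[volume] fun y => U₀ (y - ξa τ) :=
      (measurePreserving_sub_right volume (ξa τ)).quasiMeasurePreserving.ae_eq_comp h1
    have e : (fun y => U₀ (y - ξa τ + -(ξ τ - ξa τ))) = fun y => U₀ (y - ξ τ) := by
      funext y; congr 1; abel
    rw [e] at h2
    rw [hu₀ τ hτ]
    exact h2.symm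
  -- ### (6) the a.e.-modified member with the affine frame path
  set u' : ℝ → EuclideanSpace ℝ (Fin 3) → EuclideanSpace ℝ (Fin 3) := fun τ =>
    if τ < T₁ then (fun y => U₀ (y - ξa τ)) else u τ with hu'
  have hu'rep : ∀ τ : ℝ, τ < T₁ → u' τ = fun y => U₀ (y - ξa τ) + (fun _ : ℝ => (0 : EuclideanSpace ℝ (Fin 3))) τ := by
    intro τ hτ; funext y; simp [hu', if_pos hτ]
  have hsl : ∀ τ : ℝ, u' τ =ᵐ[volume] u τ := by
    intro τ
    by_cases hτ : τ < T₁
    · simp only [hu', if_pos hτ]; exact hslice τ hτ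
    · simp only [hu', if_neg hτ]; exact EventuallyEq.rfl
  -- product-measure a.e. equality on the slab
  have hprod : (volume.restrict (Iio (0 : ℝ) ×ˢ (univ : Set (EuclideanSpace ℝ (Fin 3)))) : Measure (ℝ × EuclideanSpace ℝ (Fin 3))) =
      ((volume : Measure ℝ).restrict (Iio 0)).prod (volume : Measure (EuclideanSpace ℝ (Fin 3))) := by
    rw [Measure.volume_eq_prod, ← Measure.prod_restrict, Measure.restrict_univ]
  have hum : AEStronglyMeasurable (uncurry u)
      (volume.restrict (Iio (0 : ℝ) ×ˢ (univ : Set (EuclideanSpace ℝ (Fin 3))))) := by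
    have := hH.locallyIntegrableOn.aestronglyMeasurable
    simpa [slab] using this
  have hu'm : AEStronglyMeasurable (uncurry u')
      (volume.restrict (Iio (0 : ℝ) ×ˢ (univ : Set (EuclideanSpace ℝ (Fin 3))))) := by
    have hξam : Measurable ξa := (continuous_const.add ((continuous_id.sub continuous_const).smul continuous_const)).measurable
    have h1 : AEStronglyMeasurable (fun z : ℝ × EuclideanSpace ℝ (Fin 3) => U₀ (z.2 - ξa z.1))
        (volume : Measure (ℝ × EuclideanSpace ℝ (Fin 3))) := by
      have hq : Measure.QuasiMeasurePreserving (fun z : ℝ × EuclideanSpace ℝ (Fin 3) => z.2 - ξa z.1)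
          (volume : Measure (ℝ × EuclideanSpace ℝ (Fin 3))) volume := by
        have h := (Measure.quasiMeasurePreserving_snd (μ := (volume : Measure ℝ))
          (ν := (volume : Measure (EuclideanSpace ℝ (Fin 3))))).comp (measurePreserving_frameShear hξam).quasiMeasurePreserving
        rw [Measure.volume_eq_prod]
        exact h
      exact hU₀m.comp_quasiMeasurePreserving hq
    set Sl : Set (ℝ × EuclideanSpace ℝ (Fin 3)) := Iio T₁ ×ˢ univ with hSl
    have hSlm : MeasurableSet Sl := measurableSet_Iio.prod MeasurableSet.univ
    have e : uncurry u' = Sl.piecewise (fun z => U₀ (z.2 - ξa z.1)) (uncurry u) := by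
      funext z
      by_cases hz : z ∈ Sl
      · have hz1 : z.1 < T₁ := (mem_prod.1 hz).1
        rw [piecewise_eq_of_mem _ _ _ hz]; simp [uncurry, hu', if_pos hz1]
      · have hz1 : ¬ z.1 < T₁ := fun h => hz (mem_prod.2 ⟨h, mem_univ _⟩)
        rw [piecewise_eq_of_notMem _ _ _ hz]; simp [uncurry, hu', if_neg hz1]
    rw [e]
    exact AEStronglyMeasurable.piecewise hSlm (h1.mono_measure (Measure.restrict_le_self.trans Measure.restrict_le_self))
      (hum.mono_measure Measure.restrict_le_self)
  have hae : uncurry u =ᵐ[volume.restrict (Iio (0 : ℝ) ×ˢ (univ : Set (EuclideanSpace ℝ (Fin 3))))] uncurry u' := by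
    rw [hprod] at hum hu'm ⊢
    exact ae_eq_prod_of_ae_ae_eq hum hu'm (Eventually.of_forall fun τ => (hsl τ).symm)
  have hae' : ∀ᵐ z ∂(volume.restrict ((slab (EuclideanSpace ℝ (Fin 3)) (Iio 0) isOpen_Iio :
      Opens (ℝ × EuclideanSpace ℝ (Fin 3))) : Set (ℝ × EuclideanSpace ℝ (Fin 3)))), uncurry u z = uncurry u' z := by
    rw [coe_slab]; exact hae
  -- ### (7) the modified member is in the class, with the same gauges
  have hsw' : IsSuitableWeakSolutionOn (slab (EuclideanSpace ℝ (Fin 3)) (Iio 0) isOpen_Iio) 0 0 u' p :=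
    hsw.congr_ae hae' (Eventually.of_forall fun _ => rfl)
  have hH' : HasWeakSpatialGradientOn (slab (EuclideanSpace ℝ (Fin 3)) (Iio 0) isOpen_Iio) u' H := hH.congr_ae hae'
  have hc' : ∀ a : ℝ, 0 < a → ENNReal.ofReal (a ^ (2 * ρ)) * cknA a (0 : ℝ × EuclideanSpace ℝ (Fin 3)) u' +
      ENNReal.ofReal (a ^ ρ) * cknE a (0 : ℝ × EuclideanSpace ℝ (Fin 3)) H +
      ENNReal.ofReal (a ^ (2 * ρ)) * cknD a (0 : ℝ × EuclideanSpace ℝ (Fin 3)) p ≤ (c : ℝ≥0∞) := by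
    intro a ha
    rw [cknA_congr_of_slice_ae (v := u') (w := u) (fun t _ => hsl t)]
    exact hc a ha
  -- ### (8) the affine path is sub-critically confined (`β = 1`): the confined theorem kills the member
  set K : ℝ := ‖ξ τ₀‖ + (1 + |τ₀|) * ‖deriv ξ τ₀‖ with hK
  have hK0 : 0 ≤ K := by rw [hK]; positivity
  have hξab : ∀ τ : ℝ, τ < T₁ → ‖ξa τ‖ ≤ K * (1 + |τ|) ^ (1 : ℝ) := by
    intro τ _
    rw [Real.rpow_one, hξa, hK]
    calc ‖ξ τ₀ + (τ - τ₀) • deriv ξ τ₀‖ ≤ ‖ξ τ₀‖ + ‖(τ - τ₀) • deriv ξ τ₀‖ := norm_add_le _ _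
      _ = ‖ξ τ₀‖ + |τ - τ₀| * ‖deriv ξ τ₀‖ := by rw [norm_smul, Real.norm_eq_abs]
      _ ≤ ‖ξ τ₀‖ + (|τ| + |τ₀|) * ‖deriv ξ τ₀‖ := by gcongr; exact abs_sub _ _
      _ ≤ (‖ξ τ₀‖ + (1 + |τ₀|) * ‖deriv ξ τ₀‖) * (1 + |τ|) := by
          nlinarith [norm_nonneg (ξ τ₀), norm_nonneg (deriv ξ τ₀), abs_nonneg τ, abs_nonneg τ₀,
            mul_nonneg (abs_nonneg τ) (abs_nonneg τ₀), mul_nonneg (norm_nonneg (deriv ξ τ₀)) (mul_nonneg (abs_nonneg τ) (abs_nonneg τ₀))]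
  have hkill := FrameSteady.ae_eq_zero_of_gauge_of_pastFrameSteady_confined hρ hρ1 hsw' hH' hc' hT₁ hu'rep hK0
    (β := 1) (by linarith) hξab
  exact hae.trans hkill

/-- **F1e OF LINE `galilean-frames`** (`Sig.stub_frameSteadyEscaping` of `Cruxes/PowerGaugeEulerLiouville/Lines/galilean_frames.lean`, body
verbatim with the line's `InClass` / `IsSubcriticalFrame` / `VanishesAE` unfolded): a frame-steady member of the class whose `C¹` frame path is
NOT sub-critically confined is trivial.  (The escaping hypothesis is not used: `frameSteady_ae_eq_zero` kills every frame-steady member.) [folklore] -/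
theorem frameSteadyEscaping :
    ∀ ρ : ℝ, 0 < ρ → ρ ≤ 1 / 2 →
      ∀ (u : ℝ → EuclideanSpace ℝ (Fin 3) → EuclideanSpace ℝ (Fin 3)) (p : ℝ → EuclideanSpace ℝ (Fin 3) → ℝ)
        (H : ℝ → EuclideanSpace ℝ (Fin 3) → EuclideanSpace ℝ (Fin 3) →L[ℝ] EuclideanSpace ℝ (Fin 3)) (c : ℝ≥0),
      (IsSuitableWeakSolutionOn (slab (EuclideanSpace ℝ (Fin 3)) (Set.Iio 0) isOpen_Iio) 0 0 u p ∧
        HasWeakSpatialGradientOn (slab (EuclideanSpace ℝ (Fin 3)) (Set.Iio 0) isOpen_Iio) u H ∧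
        (∀ a : ℝ, 0 < a →
          ENNReal.ofReal (a ^ (2 * ρ)) * cknA a (0 : ℝ × EuclideanSpace ℝ (Fin 3)) u +
              ENNReal.ofReal (a ^ ρ) * cknE a (0 : ℝ × EuclideanSpace ℝ (Fin 3)) H +
            ENNReal.ofReal (a ^ (2 * ρ)) * cknD a (0 : ℝ × EuclideanSpace ℝ (Fin 3)) p ≤ (c : ℝ≥0∞))) →
      ∀ (T₁ : ℝ) (U : EuclideanSpace ℝ (Fin 3) → EuclideanSpace ℝ (Fin 3)) (ξ η : ℝ → EuclideanSpace ℝ (Fin 3)),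
        T₁ ≤ 0 → ContDiff ℝ 1 ξ → (∀ τ : ℝ, τ < T₁ → u τ = fun y => U (y - ξ τ) + η τ) →
        ¬ (∃ K β : ℝ, 0 ≤ K ∧ β * (1 - ρ) < 1 ∧ ∀ τ : ℝ, τ < T₁ → ‖ξ τ‖ ≤ K * (1 + |τ|) ^ β) →
        Function.uncurry u =ᵐ[volume.restrict (Set.Iio (0 : ℝ) ×ˢ (Set.univ : Set (EuclideanSpace ℝ (Fin 3))))] 0 :=
  fun _ hρ hρ2 _ _ _ _ h _ _ _ _ hT₁ hξ hu _ => frameSteady_ae_eq_zero hρ hρ2 h.1 h.2.1 h.2.2 hT₁ hξ hu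

/-- **F1 OF LINE `galilean-frames`** (`Sig.stub_frameSteady`, body with the line's `InClass` / `IsPastFrameSteady` / `VanishesAE` unfolded):
every FRAME-STEADY past member of Seregin's class — one profile carried along an arbitrary `C¹` frame path with an arbitrary uniform
background — is trivial (`0 < ρ ≤ 1/2`). [folklore; MajdaBertozzi2002 Prop. 1.1 p. 12] -/
theorem frameSteady_stratum :
    ∀ ρ : ℝ, 0 < ρ → ρ ≤ 1 / 2 →
      ∀ (u : ℝ → EuclideanSpace ℝ (Fin 3) → EuclideanSpace ℝ (Fin 3)) (p : ℝ → EuclideanSpace ℝ (Fin 3) → ℝ)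
        (H : ℝ → EuclideanSpace ℝ (Fin 3) → EuclideanSpace ℝ (Fin 3) →L[ℝ] EuclideanSpace ℝ (Fin 3)) (c : ℝ≥0),
      (IsSuitableWeakSolutionOn (slab (EuclideanSpace ℝ (Fin 3)) (Set.Iio 0) isOpen_Iio) 0 0 u p ∧
        HasWeakSpatialGradientOn (slab (EuclideanSpace ℝ (Fin 3)) (Set.Iio 0) isOpen_Iio) u H ∧
        (∀ a : ℝ, 0 < a →
          ENNReal.ofReal (a ^ (2 * ρ)) * cknA a (0 : ℝ × EuclideanSpace ℝ (Fin 3)) u +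
              ENNReal.ofReal (a ^ ρ) * cknE a (0 : ℝ × EuclideanSpace ℝ (Fin 3)) H +
            ENNReal.ofReal (a ^ (2 * ρ)) * cknD a (0 : ℝ × EuclideanSpace ℝ (Fin 3)) p ≤ (c : ℝ≥0∞))) →
      (∃ (T₁ : ℝ) (U : EuclideanSpace ℝ (Fin 3) → EuclideanSpace ℝ (Fin 3)) (ξ η : ℝ → EuclideanSpace ℝ (Fin 3)),
        T₁ ≤ 0 ∧ ContDiff ℝ 1 ξ ∧ ∀ τ : ℝ, τ < T₁ → u τ = fun y => U (y - ξ τ) + η τ) →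
        Function.uncurry u =ᵐ[volume.restrict (Set.Iio (0 : ℝ) ×ˢ (Set.univ : Set (EuclideanSpace ℝ (Fin 3))))] 0 :=
  fun _ hρ hρ2 _ _ _ _ h ⟨_, _, _, _, hT₁, hξ, hu⟩ => frameSteady_ae_eq_zero hρ hρ2 h.1 h.2.1 h.2.2 hT₁ hξ hu

end Stratum

end GalileanFrames

end Summit.NavierStokesRegularity.NavierStokesRegularity.Theorems.PowerGaugeEulerLiouville
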